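import Summits.QuantumFields.YangMills.Theses.StretchedTail
import Literature.MathematicalPhysics.QuantumFieldTheory.Balaban1983to89.T3AveragedTailProfile
import Literature.MathematicalPhysics.QuantumFieldTheory.Balaban1983to89.T3Thresholds

/-!
# Route `StretchedTail` (rung R3 of LADDER-YM), support item `HistoryTailOfOrlicz` (stmt-QuantumFields-27837): THE ORLICZ GLUE —
# `OrliczTailL → (∀ L b₁ p₁, ∃ (b₀, p₀) ≥ (b₁, p₁), ∀ m > 0, ∃ γ₁ > 0, ∀ F γ ≤ γ₁, HistoryTailAt F γ b₀ p₀ m)` — PROVED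

Cell `ym3-torus`, width seat `ym-ust-19936-w4` g7 (row (L3) of LEAD `ym-ust-19936-w1` g5, ★★OWNER ACK 58 (1) «cross-route doors GO»);
`--supports stmt-QuantumFields-19936 --as helper`.  The item is the glue of the ideator line «stretched-tail» (route
`StretchedTail`, seat ym-r3-idea-2 g4) on the crux `UnitScaleTilt.HistoryTailL` (stmt-QuantumFields-19936).

THE ARGUMENT (three steps, all bookkeeping).

* §1 `averagedTailAt_of_perPlaquette_logSq` — THE UNION BOUND NEEDS ONLY LOG-SQUARE TAILS: if every block-averaged plaquette of every
  height `1 ≤ j ≤ K` has `Gibbs_K{θ(K−j) ≤ |Ū^{j}(∂p) − 1|} ≤ C·β_{K−j}^A·exp(−c·(1 + log g_{K−j}⁻¹)²)` for SOME `c > 0` (any polynomial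
  prefactor `β^A`), then `AveragedTailAt F γ b₀ p₀` — VERBATIM the arithmetic of the tree's
  `T3AveragedTailProfile.averagedTailAt_of_perPlaquette` / `perHeight_bound` read at the exponent profile `(1, 1)` (that proof only ever used
  `p(g_i) ≥ b₀·(1 + log g_i⁻¹) ≥ ½b₀·i·log L`, i.e. the log-square strength; Gaussian-in-`i` beats `L^{(3+A)i}` for every `c > 0`).  The
  THRESHOLD profile `(b₀, p₀)` of the event and the RATE are decoupled.
* §2 `perPlaquette_of_orlicz` — ψ_α-CHEBYSHEV: on `{θ(K−j) ≤ |Ū^{j}(∂p) − 1|}` one has `|Ū^{j}(∂p) − 1|/(C g) ≥ p(g)/C ≥ 0`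
  (`θ(i) = g_i·p(g_i)`), so Markov through the monotone envelope `exp((·/(Cg))^α)` and the Orlicz bound `∫ exp((|Ū^{j}(∂p) − 1|/(Cg))^α) ≤ D·β^A`
  give `Gibbs_K{…} ≤ D·β^A·exp(−(p(g)/C)^α)`, and `(p(g)/C)^α = (b₀/C)^α·(1 + log g⁻¹)^{αp₀} ≥ (b₀/C)^α·(1 + log g⁻¹)²` once `αp₀ ≥ 2`
  (base `≥ 1` because `g ≤ 1`).
* §3 `historyTailOfOrlicz_proof` — the item BY NAME: given `L` take `(α, γ₁)` from `OrliczTailL`; given `(b₁, p₁)` put `b₀ := max b₁ 1`,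
  `p₀ := max p₁ (max 3 (2/α))` (BEFORE `m`); for `(F, γ)` take `(C, D, A)`; §2 ⇒ §1 (`c := (b₀/C)^α`) ⇒ `AveragedTailAt` ⇒
  `T3BareTailProfile.historyTailAt_of_averagedTailAt` (bare height landed) ⇒ `HistoryTailAt F γ b₀ p₀ m` for every `m ≥ 1`.
  Corollary `historyTailL_of_orliczTailL : OrliczTailL → UnitScaleTilt.HistoryTailL` (the crux BY NAME from the line's key lemma).

HONEST FRAMING.  This closes the route's SUPPORT item only (probability bookkeeping: Markov on an Orlicz norm + a union bound); the crux
`OrliczTailL` (a `K`- and height-uniform ψ_α bound under the interacting Wilson–Gibbs laws, XL, unprinted for non-abelian d = 3) and the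
parent route's residual cruxes (stmt-19200, stmt-20520) stay OPEN; `HistoryTailL` stays open behind `OrliczTailL`.  Rung R3 (`YM3TorusSU2`,
SU(2) Yang–Mills on finite 3-tori) is a RECORD rung — not d = 4, not the continuum Clay problem; the Yang–Mills mass gap is NOT proved by any of
this.  No `def`, no `sorry`.  REMARK for the line's tribunal: §1 shows the minimal per-plaquette input of the whole `HistoryTailL` bookkeeping is a
LOG-SQUARE tail `exp(−c(1 + log g⁻¹)²)` with ANY `c > 0` — weaker than every ψ_α; the route's own kill scenario («only `exp(−c·log²)` tails at
depth `j ≥ K/2`») would therefore still feed 19936 provided its `c` and prefactor are `K`-uniform.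

References: T. Bałaban, CMP **102** (1985) 255–275 [Balaban1985UV3] ((7) p.257, (71) p.273); C. King, CMP **102** (1986) 649–677 [King1986]
((3.12) p.657); R. Vershynin, *High-Dimensional Probability* (2018) §2.7 (Orlicz norms ψ_α, Chebyshev in Orlicz form).
-/

set_option autoImplicit false

noncomputable section

open MeasureTheory
open scoped BigOperators
open Literature.MathematicalPhysics.QuantumFieldTheory
open Literature.MathematicalPhysics.QuantumFieldTheory.Balaban1983to89
open Literature.MathematicalPhysics.QuantumFieldTheory.Balaban1983to89.T3ContinuumYM3Torus
open Literature.MathematicalPhysics.QuantumFieldTheory.Balaban1983to89.T3UnitScaleTilt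
open Literature.MathematicalPhysics.QuantumFieldTheory.Balaban1983to89.T3UnitLawDensityEML
open Literature.MathematicalPhysics.QuantumFieldTheory.Balaban1983to89.T3CruxEstimates
open Literature.MathematicalPhysics.QuantumFieldTheory.Balaban1983to89.T3BareTailProfile
open Literature.MathematicalPhysics.QuantumFieldTheory.Balaban1983to89.T3AveragedTailProfile
open Literature.MathematicalPhysics.QuantumFieldTheory.Balaban1983to89.T3Thresholds
open Literature.MathematicalPhysics.QuantumFieldTheory.Balaban1983to89.T3ThresholdSmallness (sqrt_coupling_pos_le)

namespace Summit.QuantumFields.YangMills.Theorems.StretchedTailHistoryTailOfOrlicz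

/-! ## §0 Markov through a monotone envelope -/

/-- **MARKOV THROUGH AN ENVELOPE**: if an event `E` lies inside `{M₀ ≤ f}` for an integrable `f ≥ 0` and a level `M₀ > 0`, then
`μ.real E ≤ (∫ f dμ)/M₀` (finite measure). [folklore] -/
theorem measureReal_le_integral_div {Ω : Type*} [MeasurableSpace Ω] {μ : Measure Ω} [IsFiniteMeasure μ]
    {f : Ω → ℝ} (hf0 : ∀ ω, 0 ≤ f ω) (hf : Integrable f μ) {M₀ : ℝ} (hM₀ : 0 < M₀) {E : Set Ω}
    (hE : ∀ ω ∈ E, M₀ ≤ f ω) : μ.real E ≤ (∫ ω, f ω ∂μ) / M₀ := by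
  rw [le_div_iff₀ hM₀]
  have h1 : μ.real E ≤ μ.real {ω | M₀ ≤ f ω} := measureReal_mono (fun ω hω => hE ω hω) (measure_ne_top _ _)
  have h2 := mul_meas_ge_le_integral_of_nonneg (μ := μ) (ae_of_all _ hf0) hf M₀
  calc μ.real E * M₀ ≤ μ.real {ω | M₀ ≤ f ω} * M₀ := mul_le_mul_of_nonneg_right h1 hM₀.le
    _ = M₀ * μ.real {ω | M₀ ≤ f ω} := mul_comm _ _
    _ ≤ ∫ ω, f ω ∂μ := h2

/-! ## §1 The union bound needs only log-square per-plaquette tails (decoupled threshold profile and rate) -/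

/-- **`AveragedTailAt` FROM A LOG-SQUARE PER-PLAQUETTE TAIL** (`0 < γ ≤ 1`; threshold profile `(b₀, p₀)` arbitrary): if for some `C ≥ 0`,
`A : ℕ`, `c > 0` every block-averaged plaquette at every height `1 ≤ j ≤ K` of every approximation `K` has Gibbs tail
`Gibbs_K{θ(K−j) ≤ |Ū^{j}(∂p) − 1|} ≤ C·β_{K−j}^A·exp(−c·(1 + log g_{K−j}⁻¹)²)` (`g_i = √(γL^{−i})`, `θ(i) = g_i·p(g_i)` at profile `(b₀, p₀)`),
then `AveragedTailAt F γ b₀ p₀` holds with a geometric profile `A'·2^{−i}`: union bound over the `≤ 9·(2L^{m+K−j})³` plaquettes of height `j`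
and the tree's `T3AveragedTailProfile.perHeight_bound` at the exponent profile `(1, 1)` (`p_{(1,1)}(g) = 1 + log g⁻¹`).
[cite: Balaban1985UV3, (7) p.257 and (71) p.273] -/
theorem averagedTailAt_of_perPlaquette_logSq (F : T3Family) {γ b₀ p₀ : ℝ} (hγ : 0 < γ) (hγ1 : γ ≤ 1)
    (h : ∃ (C : ℝ) (A : ℕ) (c : ℝ), 0 ≤ C ∧ 0 < c ∧
      ∀ (K j : ℕ), 1 ≤ j → j ≤ K → ∀ p : Plaq (F.P K) j,
        (gibbsK F ℰp γ K).real
            {U | θBal F.L γ b₀ p₀ (K - j) ≤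
              GaugeGroup.dist1 (GaugeField.plaqHol
                (Averaging.iter (fun i => BlockAveraging.blockAvg (P := F.P K) (j := i) ℰp) j U) p)} ≤
          C * (F.scheme ℰp γ).β (K - j) ^ A *
            Real.exp (-(c * (1 + Real.log (Real.sqrt (γ * ((F.L : ℝ)⁻¹) ^ (K - j)))⁻¹) ^ 2))) :
    AveragedTailAt F γ b₀ p₀ := by
  obtain ⟨C, A, c, hC, hc, hbound⟩ := h
  have hL1 : (1 : ℝ) < F.L := by exact_mod_cast F.hL.2
  have hL0 : (0 : ℝ) < F.L := one_pos.trans hL1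
  -- the log-square factor is the `p`-function of the profile `(1, 1)`
  have hpFun : ∀ i : ℕ, (1 + Real.log (Real.sqrt (γ * ((F.L : ℝ)⁻¹) ^ i))⁻¹) ^ 2 =
      B10.pFun 1 1 (Real.sqrt (γ * ((F.L : ℝ)⁻¹) ^ i)) ^ 2 := by
    intro i
    unfold B10.pFun
    rw [Real.rpow_one, one_mul]
  -- the explicit constant of `perHeight_bound` at the profile `(1, 1)`
  obtain ⟨A', hA'def⟩ : ∃ A' : ℝ, A' = 72 * C * (F.L : ℝ) ^ (3 * F.m) * γ⁻¹ ^ A *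
      Real.exp ((((3 : ℝ) + A) * Real.log F.L + Real.log 2) ^ 2 / (4 * (c * (1 : ℝ) ^ 2 * Real.log F.L ^ 2 / 4))) := ⟨_, rfl⟩
  have hA'0 : 0 ≤ A' := by rw [hA'def]; positivity
  -- the profile
  refine ⟨fun i => A' * (1 / 2 : ℝ) ^ i, fun i => by positivity, ?_, ?_, fun K j hj1 hjK => ?_⟩
  · exact (summable_geometric_of_lt_one (by norm_num) (by norm_num)).mul_left A'
  · have heq : (fun n => ∑' t, A' * (1 / 2 : ℝ) ^ (t + n)) = fun n => (2 * A') * (1 / 2 : ℝ) ^ n := by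
      funext n
      have h1 : (fun t => A' * (1 / 2 : ℝ) ^ (t + n)) = fun t => (A' * (1 / 2 : ℝ) ^ n) * (1 / 2 : ℝ) ^ t := by
        funext t; rw [pow_add]; ring
      rw [h1, tsum_mul_left, tsum_geometric_two]; ring
    rw [heq]
    exact (summable_geometric_of_lt_one (by norm_num) (by norm_num)).mul_left (2 * A')
  -- the union bound over the plaquettes of height `j`, pulled back along the `j`-fold averaging
  haveI := isProbabilityMeasure_gibbsK F ℰp hγ.le K
  have hunion := real_not_plaqSmall_comp_le_sum (gibbsK F ℰp γ K)
    (fun U => Averaging.iter (fun i => BlockAveraging.blockAvg (P := F.P K) (j := i) ℰp) j U) (θBal F.L γ b₀ p₀ (K - j))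
  refine hunion.trans ?_
  refine (Finset.sum_le_sum fun p _ => hbound K j hj1 hjK p).trans ?_
  rw [Finset.sum_const, Finset.card_univ, nsmul_eq_mul]
  -- the number of plaquettes of height `j`: `≤ 9·(2L^{m+K−j})³`
  have hsites : ((F.P K).sitesPerDir j : ℝ) = 2 * (F.L : ℝ) ^ (F.m + (K - j)) := by
    have hs : (F.P K).sitesPerDir j = 2 * F.L ^ (F.m + (K - j)) := by
      show 2 * F.L ^ (F.m + K - j) = 2 * F.L ^ (F.m + (K - j))
      rw [show F.m + K - j = F.m + (K - j) by omega]
    rw [hs]; push_cast; ring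
  have hcardPlaq : (Fintype.card (Plaq (F.P K) j) : ℝ) ≤ 9 * ((F.P K).sitesPerDir j : ℝ) ^ 3 := by
    have h1 : Fintype.card (Plaq (F.P K) j) = Fintype.card (Plaquette 3 ((F.P K).sitesPerDir j)) :=
      Fintype.card_congr (plaqEquiv (P := F.P K) j)
    have h2 : Fintype.card (Plaquette 3 ((F.P K).sitesPerDir j)) ≤ ((F.P K).sitesPerDir j) ^ 3 * 3 ^ 2 := by
      rw [Fintype.card_prod, Fintype.card_fun, ZMod.card, Fintype.card_fin]
      gcongr
      calc Fintype.card {q : Fin 3 × Fin 3 // q.1 < q.2} ≤ Fintype.card (Fin 3 × Fin 3) := Fintype.card_subtype_le _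
        _ = 3 ^ 2 := by rw [Fintype.card_prod, Fintype.card_fin]; norm_num
    rw [h1]
    calc (Fintype.card (Plaquette 3 ((F.P K).sitesPerDir j)) : ℝ) ≤ (((F.P K).sitesPerDir j) ^ 3 * 3 ^ 2 : ℕ) := by
          exact_mod_cast h2
      _ = 9 * ((F.P K).sitesPerDir j : ℝ) ^ 3 := by push_cast; ring
  have hM : ((F.P K).sitesPerDir j : ℝ) ^ 3 = 8 * (F.L : ℝ) ^ (3 * F.m) * ((F.L : ℝ) ^ (K - j)) ^ 3 := by
    rw [hsites]; ring
  have hcard : (Fintype.card (Plaq (F.P K) j) : ℝ) ≤ 9 * (8 * (F.L : ℝ) ^ (3 * F.m) * ((F.L : ℝ) ^ (K - j)) ^ 3) := by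
    rw [← hM]; exact hcardPlaq
  have hnonneg : 0 ≤ C * (F.scheme ℰp γ).β (K - j) ^ A *
      Real.exp (-(c * (1 + Real.log (Real.sqrt (γ * ((F.L : ℝ)⁻¹) ^ (K - j)))⁻¹) ^ 2)) :=
    mul_nonneg (mul_nonneg hC (pow_nonneg (F.scheme_β_nonneg ℰp hγ.le (K - j)) A)) (Real.exp_nonneg _)
  refine (mul_le_mul_of_nonneg_right hcard hnonneg).trans ?_
  rw [hA'def, hpFun (K - j)]
  exact perHeight_bound F hγ hγ1 one_pos (le_refl (1 : ℝ)) hC A hc (K - j)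

/-! ## §2 ψ_α-Chebyshev: the per-plaquette log-square tail from the Orlicz bound -/

/-- **THE PER-PLAQUETTE TAIL FROM THE ψ_α-ORLICZ BOUND** (`0 < γ ≤ 1`, `0 ≤ b₀`, `α > 0`, `αp₀ ≥ 2`, `C > 0`; one family, one coupling):
if for every cut-off `K`, height `1 ≤ j ≤ K` and plaquette `p` the function `U ↦ exp((|Ū^{j}(∂p) − 1|/(C·g_{K−j}))^α)` is `Gibbs_K`-integrable
with integral `≤ D·β_{K−j}^A`, then `Gibbs_K{θ(K−j) ≤ |Ū^{j}(∂p) − 1|} ≤ D·β_{K−j}^A·exp(−(b₀/C)^α·(1 + log g_{K−j}⁻¹)²)` — Markov through the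
monotone envelope at the level `exp((p(g)/C)^α)` (`θ(i) = g_i·p(g_i)`), and `(p(g)/C)^α = (b₀/C)^α(1 + log g⁻¹)^{αp₀} ≥ (b₀/C)^α(1 + log g⁻¹)²`
(`1 + log g⁻¹ ≥ 1` as `g ≤ 1`). [cite: Balaban1985UV3, (7) p.257 and (71) p.273] -/
theorem perPlaquette_of_orlicz (F : T3Family) {γ b₀ p₀ α C D : ℝ} {A : ℕ} (hγ : 0 < γ) (hγ1 : γ ≤ 1) (hb₀ : 0 ≤ b₀)
    (hα : 0 < α) (hαp : 2 ≤ α * p₀) (hC : 0 < C)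
    (h : ∀ (K j : ℕ), 1 ≤ j → j ≤ K → ∀ p : Plaq (F.P K) j,
      Integrable (fun U => Real.exp ((GaugeGroup.dist1 (GaugeField.plaqHol
          (Averaging.iter (fun i => BlockAveraging.blockAvg (P := F.P K) (j := i) ℰp) j U) p) /
            (C * Real.sqrt (γ * ((F.L : ℝ)⁻¹) ^ (K - j)))) ^ α)) (gibbsK F ℰp γ K) ∧
        ∫ U, Real.exp ((GaugeGroup.dist1 (GaugeField.plaqHol
            (Averaging.iter (fun i => BlockAveraging.blockAvg (P := F.P K) (j := i) ℰp) j U) p) /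
              (C * Real.sqrt (γ * ((F.L : ℝ)⁻¹) ^ (K - j)))) ^ α) ∂(gibbsK F ℰp γ K) ≤
          D * (F.scheme ℰp γ).β (K - j) ^ A) :
    ∀ (K j : ℕ), 1 ≤ j → j ≤ K → ∀ p : Plaq (F.P K) j,
      (gibbsK F ℰp γ K).real
          {U | θBal F.L γ b₀ p₀ (K - j) ≤
            GaugeGroup.dist1 (GaugeField.plaqHol
              (Averaging.iter (fun i => BlockAveraging.blockAvg (P := F.P K) (j := i) ℰp) j U) p)} ≤
        D * (F.scheme ℰp γ).β (K - j) ^ A *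
          Real.exp (-((b₀ / C) ^ α * (1 + Real.log (Real.sqrt (γ * ((F.L : ℝ)⁻¹) ^ (K - j)))⁻¹) ^ 2)) := by
  intro K j hj1 hjK p
  haveI := isProbabilityMeasure_gibbsK F ℰp hγ.le K
  have hL : 1 ≤ F.L := F.hL.2.le
  obtain ⟨hint, hI⟩ := h K j hj1 hjK p
  set g : ℝ := Real.sqrt (γ * ((F.L : ℝ)⁻¹) ^ (K - j)) with hg
  have hg0 : 0 < g := (sqrt_coupling_pos_le hL hγ (K - j)).1
  have hg1 : g ≤ 1 := coupling_le_one hL hγ hγ1 (K - j)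
  set u : ℝ := 1 + Real.log g⁻¹ with hu
  have hu1 : 1 ≤ u := by
    have : 0 ≤ Real.log g⁻¹ := by
      rw [Real.log_inv]; exact neg_nonneg.mpr (Real.log_nonpos hg0.le hg1)
    rw [hu]; linarith
  have hu0 : 0 < u := by linarith
  -- `p(g) = b₀ u^{p₀} ≥ 0` and the Chebyshev level `M₀ = exp((p(g)/C)^α)`
  have hpF : B10.pFun b₀ p₀ g = b₀ * u ^ p₀ := rfl
  have hP0 : 0 ≤ B10.pFun b₀ p₀ g := by rw [hpF]; exact mul_nonneg hb₀ (Real.rpow_nonneg hu0.le _)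
  have hM₀pos : 0 < Real.exp ((B10.pFun b₀ p₀ g / C) ^ α) := Real.exp_pos _
  -- the event lies inside `{M₀ ≤ φ}`
  have hE : ∀ U ∈ {U : GaugeField (F.P K) 0 (Matrix.specialUnitaryGroup (Fin 2) ℂ) | θBal F.L γ b₀ p₀ (K - j) ≤
        GaugeGroup.dist1 (GaugeField.plaqHol
          (Averaging.iter (fun i => BlockAveraging.blockAvg (P := F.P K) (j := i) ℰp) j U) p)},
      Real.exp ((B10.pFun b₀ p₀ g / C) ^ α) ≤
        Real.exp ((GaugeGroup.dist1 (GaugeField.plaqHol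
          (Averaging.iter (fun i => BlockAveraging.blockAvg (P := F.P K) (j := i) ℰp) j U) p) / (C * g)) ^ α) := by
    intro U hU
    simp only [Set.mem_setOf_eq] at hU
    rw [θBal_eq, ← hg] at hU
    refine Real.exp_le_exp.mpr (Real.rpow_le_rpow (div_nonneg hP0 hC.le) ?_ hα.le)
    rw [div_le_div_iff₀ hC (mul_pos hC hg0)]
    have h1 := mul_le_mul_of_nonneg_left hU hC.le
    nlinarith [h1, hg0.le, hP0]
  have hmarkov := measureReal_le_integral_div (μ := gibbsK F ℰp γ K) (fun U => (Real.exp_pos _).le) hint hM₀pos hE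
  refine hmarkov.trans ?_
  have hDβ : 0 ≤ D * (F.scheme ℰp γ).β (K - j) ^ A := le_trans (integral_nonneg fun U => (Real.exp_pos _).le) hI
  calc _ ≤ (D * (F.scheme ℰp γ).β (K - j) ^ A) / Real.exp ((B10.pFun b₀ p₀ g / C) ^ α) :=
        div_le_div_of_nonneg_right hI hM₀pos.le
    _ = D * (F.scheme ℰp γ).β (K - j) ^ A * Real.exp (-((B10.pFun b₀ p₀ g / C) ^ α)) := by
        rw [Real.exp_neg, div_eq_mul_inv]
    _ ≤ D * (F.scheme ℰp γ).β (K - j) ^ A * Real.exp (-((b₀ / C) ^ α * u ^ 2)) := by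
        refine mul_le_mul_of_nonneg_left (Real.exp_le_exp.mpr (neg_le_neg ?_)) hDβ
        rw [hpF, mul_div_right_comm, Real.mul_rpow (div_nonneg hb₀ hC.le) (Real.rpow_nonneg hu0.le _),
          ← Real.rpow_mul hu0.le]
        refine mul_le_mul_of_nonneg_left ?_ (Real.rpow_nonneg (div_nonneg hb₀ hC.le) _)
        calc u ^ 2 = u ^ (2 : ℝ) := (Real.rpow_two u).symm
          _ ≤ u ^ (p₀ * α) := Real.rpow_le_rpow_of_exponent_le hu1 (by nlinarith [hαp])

/-! ## §3 The support item BY NAME, and the crux `HistoryTailL` from `OrliczTailL` -/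

/-- **`HistoryTailOfOrlicz` HOLDS** (item stmt-QuantumFields-27837 of route `StretchedTail`): a `K`- and height-uniform ψ_α-Orlicz bound at
the running scale turns into K2's body `HistoryTailAt F γ b₀ p₀ m` for EVERY `m > 0`, at a profile `(b₀, p₀) = (max b₁ 1, max p₁ (max 3 (2/α)))`
above any prescribed thresholds and fixed BEFORE `m` — ψ_α-Chebyshev per plaquette (§2), the log-square union bound (§1), and the tree's
`T3BareTailProfile.historyTailAt_of_averagedTailAt` (bare height landed). [cite: Balaban1985UV3, (7) p.257 and (71) p.273; King1986, (3.12) p.657] -/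
theorem historyTailOfOrlicz_proof : Summit.QuantumFields.YangMills.Theses.StretchedTail.HistoryTailOfOrlicz := by
  intro hO L b₁ p₁
  obtain ⟨α, hα, γ₁, hγ₁, hγ₁1, H⟩ := hO L
  have hb₀ : 0 < max b₁ 1 := lt_of_lt_of_le one_pos (le_max_right _ _)
  have hp₀3 : (3 : ℝ) ≤ max p₁ (max 3 (2 / α)) := (le_max_left _ _).trans (le_max_right _ _)
  have hαp : 2 ≤ α * max p₁ (max 3 (2 / α)) := by
    have h2 : 2 / α ≤ max p₁ (max 3 (2 / α)) := (le_max_right _ _).trans (le_max_right _ _)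
    have h3 : α * (2 / α) = 2 := by field_simp
    nlinarith [mul_le_mul_of_nonneg_left h2 hα.le, h3]
  refine ⟨max b₁ 1, max p₁ (max 3 (2 / α)), le_max_left _ _, le_max_left _ _, hb₀, by linarith,
    fun m hm => ⟨γ₁, hγ₁, fun F γ hFL hγ hγle => ?_⟩⟩
  obtain ⟨C, D, A, hC, hD, hK⟩ := H F γ hFL hγ hγle
  refine historyTailAt_of_averagedTailAt F hγ (hγle.trans hγ₁1) hb₀ (by linarith) hm ?_
  exact averagedTailAt_of_perPlaquette_logSq F hγ (hγle.trans hγ₁1)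
    ⟨D, A, (max b₁ 1 / C) ^ α, hD, Real.rpow_pos_of_pos (div_pos hb₀ hC) α,
      perPlaquette_of_orlicz F hγ (hγle.trans hγ₁1) hb₀.le hα hαp hC hK⟩

/-- **COROLLARY — the crux `UnitScaleTilt.HistoryTailL` (stmt-QuantumFields-19936) BY NAME from the line's key lemma `OrliczTailL`**
(stmt-QuantumFields-27836, OPEN): the stretched-exponential line reduces the history tail to ONE analytic statement.  `OrliczTailL` is NOT
proved here. [cite: Balaban1985UV3, (71) p.273] -/
theorem historyTailL_of_orliczTailL (hO : Summit.QuantumFields.YangMills.Theses.StretchedTail.OrliczTailL) :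
    Summit.QuantumFields.YangMills.Theses.UnitScaleTilt.HistoryTailL :=
  historyTailOfOrlicz_proof hO

end Summit.QuantumFields.YangMills.Theorems.StretchedTailHistoryTailOfOrlicz

end
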